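import Literature.Probability.LatticeModels.ExplorationWinding
import Literature.Probability.LatticeModels.MedialWindingBridge
import Summits.CriticalPhenomena.CardyFormulaZ2.Theorems.CardyComplexConeEdgePrecompactPassageSync

/-!
# Hull stability, deterministic part: passage agreement from exterior responses
(line `qkz-strip-boundary-arm` of crux `CardyComplexCone.EdgePrecompact`, stmt-CriticalPhenomena-11387)

Pointwise (every configuration, no probability) half of the hull-stability hypothesis of the landed
reduction `shiftCouplingLocality_of_hullStability`
(`Theorems/CardyComplexConeEdgePrecompactShiftCouplingLocalityReduction.lean`): for two admissible
discrete Dobrushin data `E₀, E₁` of the same mesh which are DEEP around a ball `B(z, r)` (every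
lattice edge at a site within `R ≥ r + 10δ` of `z` is an edge of both discrete domains — so that the
two completed configurations agree on the ball, all faces near it are inner for both, and no marked
edge lies in it), and one configuration `ω`: IF the initial stretches of the two exploration orbits
and the exterior stretches of the two dynamics from every exit corner of the ball RESPOND ALIKE
(same re-entry corner through inner faces, same accumulated turning; the premises of the
synchronisation theorem `passageSync`), THEN the two exploration paths `medialExploration Eᵢ ω`
traverse any dart inside the ball with the same set of prefix windings — the passage-agreement
property whose failure, for some filling of the ball, is the event of the hull-stability hypothesis.

Contents: consequences of depth (`isInnerFace_of_deep`, `not_mem_zdBoundary_of_deep`,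
`mem_bcBondConfig_iff_of_deep`), the exploration path as a cut orbit with its exit time
(`exists_explorationList_eq`), traversal positions as orbit times (`passage_iff`), prefix windings as
turning sums (`winding_take_explorationList`, via `winding_orbitPts` of `ExplorationWinding.lean` and
the bridge `Polyline.winding_eq_winding`), and the registered sub-goal `passageAgree_of_response`.
In this file `Polyline.winding` is always written qualified (the cone contains both copies of the
polyline winding, `MedialWindingBridge.lean`).

References: S. Smirnov, C. R. Acad. Sci. Paris 333 (2001), §2; S. Smirnov, Ann. of Math. 172
(2010), §2.2; G. Grimmett, *Percolation* (1999), §11.2.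
-/

namespace Summit.CriticalPhenomena.CardyFormulaZ2.Cruxes.EdgePrecompact.QkzStripBoundaryArm

open MeasureTheory Filter Set Metric
open scoped Topology BigOperators Pointwise
open Literature.Probability.LatticeModels Literature.Probability.Percolation
open Literature.Probability.RandomPlanarGeometry (DobrushinDomain)
open Summit.CriticalPhenomena.CardyFormulaZ2.Theses.CardyComplexCone

noncomputable section

/-! ## Depth: every lattice edge near `z` is an edge of the discrete domain -/

/-- The far endpoint of the source edge of a coded corner is within `4δ` of its vertex (both are
corners of the face `faceAt x k`). -/
theorem dist_meshPoint_add_cornerUnit_le {δ : ℝ} (hδ : 0 ≤ δ) (x : Site 2) (k : Fin 4) :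
    dist (meshPoint δ (x + cornerUnit k)) (meshPoint δ x) ≤ 4 * δ := by
  have h1 := dist_meshPoint_le_of_isCorner hδ
    (isCorner_of_mem_cSrc (x := x) (k := k) (Or.inl rfl) (Sym2.mem_mk_right _ _))
  have h2 := dist_meshPoint_le_of_isCorner hδ (isCorner_faceAt x k)
  have h3 := dist_triangle (meshPoint δ (x + cornerUnit k)) (meshPoint δ (faceAt x k))
    (meshPoint δ x)
  rw [dist_comm (meshPoint δ (faceAt x k))] at h3
  linarith

section Deep

variable {E : DiscreteDobrushin} {z : ℂ} {R : ℝ}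
  (hdeep : ∀ x y : Site 2, dist (meshPoint E.δ x) z < R → (zdGraph 2).Adj x y →
    (discreteDomainGraph E.Ω E.δ).Adj x y)
  (hδ : 0 ≤ E.δ)
include hdeep hδ

/-- Faces within `R - 2δ` of `z` are inner. -/
theorem isInnerFace_of_deep {f : Site 2} (hf : dist (meshPoint E.δ f) z < R - 2 * E.δ) :
    E.IsInnerFace f := fun v w hv _ hadj =>
  hdeep v w (by
    have h1 := dist_meshPoint_le_of_isCorner hδ hv
    have h2 := dist_triangle (meshPoint E.δ v) (meshPoint E.δ f) z
    linarith) hadj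

/-- Sites within `R - 4δ` of `z` are not on the square-lattice discrete boundary. -/
theorem not_mem_zdBoundary_of_deep {x : Site 2} (hx : dist (meshPoint E.δ x) z < R - 4 * E.δ) :
    x ∉ E.zdBoundary := by
  rintro (⟨-, y, hadj, hn⟩ | ⟨y, -, -, g, hg, hxg, -⟩)
  · exact hn (hdeep x y (by linarith) hadj)
  · refine hg (isInnerFace_of_deep hdeep hδ ?_)
    have h1 := dist_meshPoint_le_of_isCorner hδ hxg
    have h2 := dist_triangle (meshPoint E.δ g) (meshPoint E.δ x) z
    rw [dist_comm] at h1
    linarith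

/-- Near `z`, the completed configuration is the configuration: a lattice edge sourced at a site
within `R - 8δ` of `z` is an edge of `Ω_δ` with no endpoint on the arcs. -/
theorem mem_bcBondConfig_iff_of_deep {x : Site 2} (k : Fin 4)
    (hx : dist (meshPoint E.δ x) z < R - 8 * E.δ) (ω : BondConfig (Site 2)) :
    cSrc (x, k) ∈ E.bcBondConfig ω ↔ cSrc (x, k) ∈ ω := by
  have hadj : (zdGraph 2).Adj x (x + cornerUnit k) := (SimpleGraph.mem_edgeSet _).1 (cSrc_mem_edgeSet (x, k))
  have hy : dist (meshPoint E.δ (x + cornerUnit k)) z < R - 4 * E.δ := by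
    have h1 := dist_meshPoint_add_cornerUnit_le hδ x k
    have h2 := dist_triangle (meshPoint E.δ (x + cornerUnit k)) (meshPoint E.δ x) z
    linarith
  have hxB := not_mem_zdBoundary_of_deep hdeep hδ (x := x) (by linarith)
  have hyB := not_mem_zdBoundary_of_deep hdeep hδ hy
  rw [cSrc, DiscreteDobrushin.mem_bcBondConfig_iff]
  constructor
  · rintro ⟨-, h | ⟨h, -⟩⟩
    · exact absurd (E.zdArcA_subset_zdBoundary (h x (Sym2.mem_mk_left _ _))) hxB
    · exact h
  · intro h
    refine ⟨(SimpleGraph.mem_edgeSet _).2 (hdeep x _ (by linarith) hadj), Or.inr ⟨h, fun u hu => ?_⟩⟩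
    rcases Sym2.mem_iff.1 hu with rfl | rfl
    · exact fun hB => hxB (E.zdArcB_subset_zdBoundary hB)
    · exact fun hB => hyB (E.zdArcB_subset_zdBoundary hB)

end Deep

/-- Pairs which are not lattice edges are never in the completed configuration. -/
theorem not_mem_bcBondConfig_of_not_mem_edgeSet (E : DiscreteDobrushin) {e : Sym2 (Site 2)}
    (he : e ∉ (zdGraph 2).edgeSet) (ω : BondConfig (Site 2)) : e ∉ E.bcBondConfig ω := fun h =>
  he (SimpleGraph.edgeSet_subset_edgeSet.2
    ((discreteDomainGraph_le_meshGraph E.Ω E.δ).trans (meshGraph_le_zdGraph E.Ω E.δ)) h.1)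

/-- The source midpoint of a coded corner is within `δ` of its vertex. -/
theorem dist_medialPoint_cSrc_le' {δ : ℝ} (hδ : 0 ≤ δ) (p : Site 2 × Fin 4) :
    dist (medialPoint δ (cSrc p)) (meshPoint δ p.1) ≤ δ := by
  rw [← cornerSource_cFace]
  exact dist_medialPoint_cornerSource_le hδ (isCorner_cFace p)

/-- The target midpoint of a coded corner is within `δ` of its vertex. -/
theorem dist_medialPoint_cTgt_le' {δ : ℝ} (hδ : 0 ≤ δ) (p : Site 2 × Fin 4) :
    dist (medialPoint δ (cTgt p)) (meshPoint δ p.1) ≤ δ := by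
  rw [← cornerTarget_cFace]
  exact dist_medialPoint_cornerTarget_le hδ (isCorner_cFace p)

/-- Every lattice edge is the source edge of a coded corner. -/
theorem exists_eq_cSrc {e : Sym2 (Site 2)} (he : e ∈ (zdGraph 2).edgeSet) :
    ∃ p : Site 2 × Fin 4, e = cSrc p := by
  induction e using Sym2.ind with
  | h x y =>
    obtain ⟨k, rfl⟩ := exists_eq_add_cornerUnit ((SimpleGraph.mem_edgeSet _).1 he)
    exact ⟨(x, k), rfl⟩

/-! ## The exploration path as a cut orbit; traversals and prefix windings -/

/-- For admissible data every configuration's exploration path is the orbit of the start corner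
cut at its (positive) exit time. -/
theorem exists_explorationList_eq {E : DiscreteDobrushin} (hE : E.IsZdAdmissible)
    (ω : BondConfig (Site 2)) :
    ∃ (c : Site 2 × Fin 4) (N : ℕ), E.IsStartCorner c ∧
      ¬ E.IsInnerFace (cFace (cornerOrbit (E.bcBondConfig ω) c N)) ∧
      (∀ k < N, E.IsInnerFace (cFace (cornerOrbit (E.bcBondConfig ω) c k))) ∧ 0 < N ∧
      medialExploration E ω = explorationList (E.bcBondConfig ω) c N := by
  classical
  obtain ⟨c, hc, -⟩ := DiscreteDobrushin.existsUnique_startCorner hE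
  have hc' : E.IsStartCorner c := ⟨hc.1, hc.2.1, hc.2.2⟩
  have hex := exists_not_isInnerFace_cornerOrbit (ω := ω) hE hc'
  have hlt : ∀ k < Nat.find hex, E.IsInnerFace (cFace (cornerOrbit (E.bcBondConfig ω) c k)) :=
    fun k hk => not_not.1 (Nat.find_min hex hk)
  refine ⟨c, Nat.find hex, hc', Nat.find_spec hex, hlt, ?_, ?_⟩
  · by_contra h0
    have h00 : Nat.find hex = 0 := by omega
    have := Nat.find_spec hex
    rw [h00] at this
    exact this hc'.isOutEdge.1
  · exact medialExploration_eq_of_existsUnique (existsUnique_medialExploration_holds E hE ω)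
      (isMedialExploration_explorationList hE hc' (Nat.find_spec hex) hlt)

/-- Traversals of the dart of the coded corner `p` by the cut orbit are the orbit times `k < N` with
`k`-th corner `p`. -/
theorem passage_iff {E : DiscreteDobrushin} {ω : BondConfig (Site 2)} (c : Site 2 × Fin 4) (N : ℕ)
    (p : Site 2 × Fin 4) (k : ℕ) :
    ((explorationList (E.bcBondConfig ω) c N)[k]? = some (cSrc p) ∧
      (explorationList (E.bcBondConfig ω) c N)[k + 1]? = some (cTgt p)) ↔
      k < N ∧ cornerOrbit (E.bcBondConfig ω) c k = p := by
  have hlen := length_explorationList (D := E) (ω := ω) (c₀ := c) N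
  constructor
  · rintro ⟨hs, ht⟩
    obtain ⟨hk, hs⟩ := List.getElem?_eq_some_iff.1 hs
    obtain ⟨hk1, ht⟩ := List.getElem?_eq_some_iff.1 ht
    rw [getElem_explorationList] at hs ht
    rw [cSrc_cornerOrbit_succ] at ht
    exact ⟨by omega, eq_of_cSrc_eq_of_cTgt_eq hs ht⟩
  · rintro ⟨hk, rfl⟩
    refine ⟨?_, ?_⟩
    · rw [List.getElem?_eq_getElem (by omega), getElem_explorationList]
    · rw [List.getElem?_eq_getElem (by omega), getElem_explorationList, cSrc_cornerOrbit_succ]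

/-- The winding of the exploration polyline up to (and including) its `k`-th dart is the sum of
its first `k` turns (`±π/2` each). -/
theorem winding_take_explorationList {δ : ℝ} (hδ : δ ≠ 0) (β : BondConfig (Site 2))
    (c : Site 2 × Fin 4) {N k : ℕ} (hk : k < N) :
    Polyline.winding (((explorationList β c N).map (medialPoint δ)).take (k + 2)) =
      ∑ i ∈ Finset.range k, turnOf β (cornerOrbit β c i) := by
  rw [Polyline.winding_eq_winding, map_medialPoint_explorationList,
    take_orbitPts δ c (Nat.succ_le_of_lt hk), winding_orbitPts hδ]
  rfl

/-! ## Passage agreement from exterior responses -/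

/-- **Passage agreement from exterior responses** (registered sub-goal `passageAgree_of_response` of
stmt-CriticalPhenomena-11387; the pointwise half of hull stability). For two admissible data
`E₀, E₁` of mesh `δ`, DEEP around the ball `B(z, r)` (every lattice edge at a site within `R` of `z`,
`r + 10δ ≤ R`, is an edge of both discrete domains), a configuration `ω` and a coded corner `p` whose
dart lies in the ball: if the INITIAL stretches of the two exploration orbits (from the two start
corners) and the EXTERIOR stretches of the two dynamics from every exit corner `q` of the ball
respond alike (premises of `passageSync`, in both directions), then the two exploration paths
traverse the dart of `p` with the same set of prefix windings. -/
theorem passageAgree_of_response : ∀ (E₀ E₁ : DiscreteDobrushin) (δ : ℝ) (z : ℂ) (r R : ℝ), E₀.IsZdAdmissible → E₁.IsZdAdmissible → E₀.δ = δ → E₁.δ = δ → r + 10 * δ ≤ R → (∀ x y : Site 2, dist (meshPoint δ x) z < R → (zdGraph 2).Adj x y → (discreteDomainGraph E₀.Ω E₀.δ).Adj x y) → (∀ x y : Site 2, dist (meshPoint δ x) z < R → (zdGraph 2).Adj x y → (discreteDomainGraph E₁.Ω E₁.δ).Adj x y) → ∀ (ω : BondConfig (Site 2)) (p : Site 2 ×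 Fin 4), medialPoint δ (cSrc p) ∈ ball z r → medialPoint δ (cTgt p) ∈ ball z r → (∀ c₀ c₁ : Site 2 × Fin 4, E₀.IsStartCorner c₀ → E₁.IsStartCorner c₁ → (∀ n : ℕ, (∀ i < n, medialPoint δ (cTgt (cornerOrbit (E₀.bcBondConfig ω) c₀ i)) ∉ ball z r ∧ E₀.IsInnerFace (cFace (cornerOrbit (E₀.bcBondConfig ω) c₀ (i + 1)))) → medialPoint δ (cTgt (cornerOrbit (E₀.bcBondConfig ω) c₀ n)) ∈ ball z r → ∃ n' : ℕ, (∀ i < n', medialPoint δ (cTgt (cornerOrbit (E₁.bcBondConfig ω) c₁ i)) ∉ ball z r ∧ E₁.IsInnerFace (cFace (cornerOrbit (E₁.bcBondConfig ω) c₁ (i + 1)))) ∧ cornerOrbit (E₁.bcBondConfig ω) c₁ n' = cornerOrbit (E₀.bcBondConfig ω) c₀ n ∧ ∑ i ∈ Finset.range n', turnOf (E₁.bcBondConfig ω) (cornerOrbit (E₁.bcBondConfig ω) c₁ i) = ∑ i ∈ Finset.range n, turnOf (E₀.bcBondConfig ω) (cornerOrbit (E₀.bcBondConfig ω) c₀ i))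 ∧ (∀ n : ℕ, (∀ i < n, medialPoint δ (cTgt (cornerOrbit (E₁.bcBondConfig ω) c₁ i)) ∉ ball z r ∧ E₁.IsInnerFace (cFace (cornerOrbit (E₁.bcBondConfig ω) c₁ (i + 1)))) → medialPoint δ (cTgt (cornerOrbit (E₁.bcBondConfig ω) c₁ n)) ∈ ball z r → ∃ n' : ℕ, (∀ i < n', medialPoint δ (cTgt (cornerOrbit (E₀.bcBondConfig ω) c₀ i)) ∉ ball z r ∧ E₀.IsInnerFace (cFace (cornerOrbit (E₀.bcBondConfig ω) c₀ (i + 1)))) ∧ cornerOrbit (E₀.bcBondConfig ω) c₀ n' = cornerOrbit (E₁.bcBondConfig ω) c₁ n ∧ ∑ i ∈ Finset.range n', turnOf (E₀.bcBondConfig ω) (cornerOrbit (E₀.bcBondConfig ω) c₀ i) = ∑ i ∈ Finset.range n, turnOf (E₁.bcBondConfig ω) (cornerOrbit (E₁.bcBondConfig ω) c₁ i))) → (∀ q : Site 2 × Fin 4, medialPoint δ (cSrc q) ∈ ball z r → medialPoint δ (cTgt q) ∉ ball z r → (∀ n : ℕ, (∀ i < n, medialPoint δ (cTgt (cornerOrbit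 (E₀.bcBondConfig ω) q i)) ∉ ball z r ∧ E₀.IsInnerFace (cFace (cornerOrbit (E₀.bcBondConfig ω) q (i + 1)))) → medialPoint δ (cTgt (cornerOrbit (E₀.bcBondConfig ω) q n)) ∈ ball z r → ∃ n' : ℕ, (∀ i < n', medialPoint δ (cTgt (cornerOrbit (E₁.bcBondConfig ω) q i)) ∉ ball z r ∧ E₁.IsInnerFace (cFace (cornerOrbit (E₁.bcBondConfig ω) q (i + 1)))) ∧ cornerOrbit (E₁.bcBondConfig ω) q n' = cornerOrbit (E₀.bcBondConfig ω) q n ∧ ∑ i ∈ Finset.range n', turnOf (E₁.bcBondConfig ω) (cornerOrbit (E₁.bcBondConfig ω) q i) = ∑ i ∈ Finset.range n, turnOf (E₀.bcBondConfig ω) (cornerOrbit (E₀.bcBondConfig ω) q i)) ∧ (∀ n : ℕ, (∀ i < n, medialPoint δ (cTgt (cornerOrbit (E₁.bcBondConfig ω) q i)) ∉ ball z r ∧ E₁.IsInnerFace (cFace (cornerOrbit (E₁.bcBondConfig ω) q (i + 1)))) → medialPoint δ (cTgt (cornerOrbit (E₁.bcBondConfig ω) q n)) ∈ ball z r → ∃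 n' : ℕ, (∀ i < n', medialPoint δ (cTgt (cornerOrbit (E₀.bcBondConfig ω) q i)) ∉ ball z r ∧ E₀.IsInnerFace (cFace (cornerOrbit (E₀.bcBondConfig ω) q (i + 1)))) ∧ cornerOrbit (E₀.bcBondConfig ω) q n' = cornerOrbit (E₁.bcBondConfig ω) q n ∧ ∑ i ∈ Finset.range n', turnOf (E₀.bcBondConfig ω) (cornerOrbit (E₀.bcBondConfig ω) q i) = ∑ i ∈ Finset.range n, turnOf (E₁.bcBondConfig ω) (cornerOrbit (E₁.bcBondConfig ω) q i))) → ∀ W : ℝ, (∃ k : ℕ, (medialExploration E₀ ω)[k]? = some (cSrc p) ∧ (medialExploration E₀ ω)[k + 1]? = some (cTgt p) ∧ Polyline.winding (((medialExploration E₀ ω).map (medialPoint δ)).take (k + 2)) = W) ↔ (∃ k : ℕ, (medialExploration E₁ ω)[k]? = some (cSrc p) ∧ (medialExploration E₁ ω)[k + 1]? = some (cTgt p) ∧ Polyline.winding (((medialExploration E₁ ω).map (medialPoint δ)).take (k + 2)) = W) := by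
  intro E₀ E₁ δ z r R hE₀ hE₁ hδ₀ hδ₁ hrR hdeep₀ hdeep₁ ω p hps hpt hInit hResp
  have hδpos : 0 < δ := hδ₀ ▸ hE₀.delta_pos
  -- the two exploration paths as cut orbits
  obtain ⟨c₀, N₀, hc₀, hN₀, hlt₀, hpos₀, hγ₀⟩ := exists_explorationList_eq hE₀ ω
  obtain ⟨c₁, N₁, hc₁, hN₁, hlt₁, hpos₁, hγ₁⟩ := exists_explorationList_eq hE₁ ω
  -- depth, in the data's own mesh
  have hdeep₀' : ∀ x y : Site 2, dist (meshPoint E₀.δ x) z < R → (zdGraph 2).Adj x y →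
      (discreteDomainGraph E₀.Ω E₀.δ).Adj x y := fun x y hx hxy =>
    hdeep₀ x y (by rwa [hδ₀] at hx) hxy
  have hdeep₁' : ∀ x y : Site 2, dist (meshPoint E₁.δ x) z < R → (zdGraph 2).Adj x y →
      (discreteDomainGraph E₁.Ω E₁.δ).Adj x y := fun x y hx hxy =>
    hdeep₁ x y (by rwa [hδ₁] at hx) hxy
  -- a vertex of an edge in the ball is within `r + δ` of the centre
  have hvtx : ∀ q : Site 2 × Fin 4, (medialPoint δ (cSrc q) ∈ ball z r ∨ medialPoint δ (cTgt q) ∈ ball z r) →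
      dist (meshPoint δ q.1) z < r + δ := by
    rintro q (hq | hq)
    · have h1 := dist_medialPoint_cSrc_le' hδpos.le q
      have h2 := dist_triangle (meshPoint δ q.1) (medialPoint δ (cSrc q)) z
      rw [dist_comm] at h1
      rw [mem_ball] at hq
      linarith
    · have h1 := dist_medialPoint_cTgt_le' hδpos.le q
      have h2 := dist_triangle (meshPoint δ q.1) (medialPoint δ (cTgt q)) z
      rw [dist_comm] at h1
      rw [mem_ball] at hq
      linarith
  -- (1) the two completed configurations agree on the ball
  have hβ : ∀ e ∈ {e : Sym2 (Site 2) | medialPoint δ e ∈ ball z r},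
      (e ∈ E₀.bcBondConfig ω ↔ e ∈ E₁.bcBondConfig ω) := by
    intro e he
    by_cases hedge : e ∈ (zdGraph 2).edgeSet
    · obtain ⟨⟨x, k⟩, rfl⟩ := exists_eq_cSrc hedge
      have hx := hvtx (x, k) (Or.inl he)
      have hx₀ : dist (meshPoint E₀.δ x) z < R - 8 * E₀.δ := by rw [hδ₀]; simp only at hx; linarith
      have hx₁ : dist (meshPoint E₁.δ x) z < R - 8 * E₁.δ := by rw [hδ₁]; simp only at hx; linarith
      rw [mem_bcBondConfig_iff_of_deep hdeep₀' (hδ₀ ▸ hδpos.le) k hx₀ ω,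
        mem_bcBondConfig_iff_of_deep hdeep₁' (hδ₁ ▸ hδpos.le) k hx₁ ω]
    · exact iff_of_false (not_mem_bcBondConfig_of_not_mem_edgeSet E₀ hedge ω)
        (not_mem_bcBondConfig_of_not_mem_edgeSet E₁ hedge ω)
  -- (2) faces of corners with an edge in the ball are inner for both data
  have hIface : ∀ q : Site 2 × Fin 4,
      (cSrc q ∈ {e : Sym2 (Site 2) | medialPoint δ e ∈ ball z r} ∨
        cTgt q ∈ {e : Sym2 (Site 2) | medialPoint δ e ∈ ball z r}) →
      E₀.IsInnerFace (cFace q) ∧ E₁.IsInnerFace (cFace q) := by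
    intro q hq
    have h1 := hvtx q hq
    have h2 := dist_meshPoint_le_of_isCorner hδpos.le (isCorner_cFace q)
    have h3 := dist_triangle (meshPoint δ (cFace q)) (meshPoint δ q.1) z
    rw [dist_comm] at h2
    exact ⟨isInnerFace_of_deep hdeep₀' (hδ₀ ▸ hδpos.le) (by rw [hδ₀]; linarith),
      isInnerFace_of_deep hdeep₁' (hδ₁ ▸ hδpos.le) (by rw [hδ₁]; linarith)⟩
  -- (3) the start edges `e_a` are marked edges, hence not in the ball
  have hstart : ∀ (E : DiscreteDobrushin) (c : Site 2 × Fin 4), E.δ = δ →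
      (∀ x y : Site 2, dist (meshPoint E.δ x) z < R → (zdGraph 2).Adj x y →
        (discreteDomainGraph E.Ω E.δ).Adj x y) →
      E.IsStartCorner c → cSrc c ∉ {e : Sym2 (Site 2) | medialPoint δ e ∈ ball z r} := by
    intro E c hEδ hdeepE hc h
    have h1 := hvtx c (Or.inl h)
    exact not_mem_zdBoundary_of_deep hdeepE (hEδ ▸ hδpos.le) (by rw [hEδ]; linarith)
      (E.zdArcA_subset_zdBoundary hc.mem_zdArcA)
  -- (4) synchronise, in both directions
  have key₀₁ := passageSync (E₀.bcBondConfig ω) (E₁.bcBondConfig ω) E₀.IsInnerFace E₁.IsInnerFace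
    {e : Sym2 (Site 2) | medialPoint δ e ∈ ball z r} c₀ c₁ N₀ N₁ hβ hIface
    (hstart E₀ c₀ hδ₀ hdeep₀' hc₀) (hstart E₁ c₁ hδ₁ hdeep₁' hc₁) hN₀ hlt₀ hpos₀ hN₁ hlt₁ hpos₁
    (hInit c₀ c₁ hc₀ hc₁).1 (fun q hq hq' => (hResp q hq hq').1)
  have key₁₀ := passageSync (E₁.bcBondConfig ω) (E₀.bcBondConfig ω) E₁.IsInnerFace E₀.IsInnerFace
    {e : Sym2 (Site 2) | medialPoint δ e ∈ ball z r} c₁ c₀ N₁ N₀ (fun e he => (hβ e he).symm)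
    (fun q hq => (hIface q hq).symm) (hstart E₁ c₁ hδ₁ hdeep₁' hc₁) (hstart E₀ c₀ hδ₀ hdeep₀' hc₀)
    hN₁ hlt₁ hpos₁ hN₀ hlt₀ hpos₀ (hInit c₀ c₁ hc₀ hc₁).2 (fun q hq hq' => (hResp q hq hq').2)
  -- (5) conclude: traversals are synchronised orbit times, prefix windings are turning sums
  intro W
  rw [hγ₀, hγ₁]
  constructor
  · rintro ⟨k, hs, ht, hW⟩
    obtain ⟨hk, hpk⟩ := (passage_iff c₀ N₀ p k).1 ⟨hs, ht⟩
    obtain ⟨k₁, hk₁, hEq, hS⟩ := key₀₁ k hk (by rw [hpk]; exact hps)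
    obtain ⟨hs₁, ht₁⟩ := (passage_iff c₁ N₁ p k₁).2 ⟨hk₁, hEq.trans hpk⟩
    refine ⟨k₁, hs₁, ht₁, ?_⟩
    rw [winding_take_explorationList hδpos.ne' _ _ hk₁, hS,
      ← winding_take_explorationList hδpos.ne' _ _ hk, hW]
  · rintro ⟨k, hs, ht, hW⟩
    obtain ⟨hk, hpk⟩ := (passage_iff c₁ N₁ p k).1 ⟨hs, ht⟩
    obtain ⟨k₀, hk₀, hEq, hS⟩ := key₁₀ k hk (by rw [hpk]; exact hps)
    obtain ⟨hs₀, ht₀⟩ := (passage_iff c₀ N₀ p k₀).2 ⟨hk₀, hEq.trans hpk⟩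
    refine ⟨k₀, hs₀, ht₀, ?_⟩
    rw [winding_take_explorationList hδpos.ne' _ _ hk₀, hS,
      ← winding_take_explorationList hδpos.ne' _ _ hk, hW]

end

end Summit.CriticalPhenomena.CardyFormulaZ2.Cruxes.EdgePrecompact.QkzStripBoundaryArm
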